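import Summits.BirchSwinnertonDyer.BirchSwinnertonDyer.Theorems.Rank1ResidualJetCebotarevAdapter
import Summits.BirchSwinnertonDyer.BirchSwinnertonDyer.Theorems.Rank1ResidualJetRingClassFields
import HarnessLib

/-!
# The walk's input `h47` (Prop. 4.7 at a prime `ℓ`, conclusion form) from McCallum's Prop. 4.4 for a
# COMPATIBLE data system on the admissible-conductor subtype (cell `bsd-stepL`, seat
# `bsd-stepL-tam3-p1`, helper toward item 19109 `EulerHalvesAtThree`, registered stub
# `stub_jetchevMaxHLAtThree`)

HONEST FRAMING. Nothing here proves BSD, J₃ or any divisibility of a Heegner point; the registered stub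
is NOT discharged; no item closes; 0 classes move (T7); `--supports stmt-BirchSwinnertonDyer-19109`
(helper). WHAT THIS FILE DOES. The printed route to the named input `h47` of
`Koly.tamagawaExponent_le_m_of_admissibleFamilies'` (p504178) ∕ of `Koly.jetchevMaxHLAtThree_of_facts_of_supply`
(p504978): if the data system `D` on the admissible-conductor subtype is COMPATIBLE along `s ↦ s·ℓ`
(`ℓ` prime) in McCallum's sense — the generators `σ`, the representatives `S` and the embeddings `emb`
of the datum at `sℓ` restrict to those at `s` (the four clauses of the typed Prop. 4.4 fact, as in
p496626's `hdata`) — then `h47` holds, by bsd-jet's `JET.addOrderOf_localization_kolyvaginClass_mul_eq_of_prop44`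
(McCallum Prop. 4.4 = [J] Prop. 4.7, the typed PRINT fact `McCallum1991.prop44_localOrder_kolyvaginClass_mul_eq`
taken as hypothesis `h44`). So `h47` ⟸ {one print fact, a compatible choice of the data}. Frame (the
fact's binders): `W` non-CM, `K` imaginary quadratic with `d_K ∉ {−3,−4}` and the Heegner hypothesis,
`p` odd with the `p`-adic tower; ring class fields are number fields (`JET.numberField_ringClassField`).
References (locators only; no cited FACT declared): [cite: Jetchev2008, Prop. 4.4 (p. 821) = arXiv
Prop. 4.7] [cite: McCallumLMS1991, §4 Prop. 4.4 (p. 301)]. Design: one theorem, no definitions;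
`K : Type`. Axioms: `propext`, `Classical.choice`, `Quot.sound`.
-/

set_option autoImplicit false

noncomputable section

open scoped Classical NumberField

namespace Summit.BirchSwinnertonDyer.Rank1Residual.X11b.Three.Koly

open WeierstrassCurve IsDedekindDomain NumberField Literature.NumberTheory.EllipticCurves
  Literature.NumberTheory.EllipticCurves.ModularForms Literature.NumberTheory.GaloisRepresentations
  Summit.BirchSwinnertonDyer.Rank1Residual.JET

/-- **`h47` of the walk (prime `ℓ`) from McCallum Prop. 4.4 for a compatible data system.** For data `D`
on the admissible-conductor subtype (level `p^k`, `k ≥ 1`) that are compatible along `s ↦ sℓ` for prime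
`ℓ ∤ s` (`hcompat`: the four clauses of the typed fact), the localisations at `λ ∋ ℓ` of `c_k(sℓ)` and
`c_k(s)` have the same order — the hypothesis `h47` of `Koly.tamagawaExponent_le_m_of_admissibleFamilies'`
VERBATIM. CONDITIONAL on the typed print fact `h44`. [cite: McCallumLMS1991, §4 Prop. 4.4 (p. 301)]
[cite: Jetchev2008, Prop. 4.4 (p. 821)] -/
theorem h47_of_prop44_of_compatData
    (h44 : McCallum1991.prop44_localOrder_kolyvaginClass_mul_eq)
    (W : WeierstrassCurve ℚ) [W.IsElliptic] [W.IsGloballyMinimal] [NeZero (W.conductorNorm ℤ)]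
    (hcm : ¬ W.HasCM) {K : Type} [Field K] [NumberField K] (hK : IsImaginaryQuadratic K)
    (hD3 : NumberField.discr K ≠ -3) (hD4 : NumberField.discr K ≠ -4)
    (hH : SatisfiesHeegnerHypothesis (W.conductorNorm ℤ) K)
    {p : ℕ} [Fact p.Prime] (hp2 : p ≠ 2) (htower : ∀ n : ℕ, W.HasSurjectiveModNGaloisRep (p ^ n : ℕ))
    (Dt : ModularParametrizationData W (W.conductorNorm ℤ)) (β : ℤ) (ι : K →+* ℂ) {k : ℕ} (hk : 1 ≤ k)
    (D : ∀ s : {m : ℕ // Squarefree m ∧ ∀ q ∈ m.primeFactors,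
        Zhang2014.IsKolyvaginPrime (W.conductorNorm ℤ) W K p q ∧ k ≤ Zhang2014.kolyvaginIndex W p q},
      KolyvaginHeegnerData Dt β ι s.1)
    (hcompat : ∀ (s s' : {m : ℕ // Squarefree m ∧ ∀ q ∈ m.primeFactors,
        Zhang2014.IsKolyvaginPrime (W.conductorNorm ℤ) W K p q ∧ k ≤ Zhang2014.kolyvaginIndex W p q})
      (ℓ : ℕ), ℓ.Prime → ¬ ℓ ∣ s.1 → s'.1 = s.1 * ℓ →
      (∀ l' ∈ s.1.primeFactors, ∀ (x : ringClassField K ι s.1) (x' : ringClassField K ι s'.1),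
        (x : ℂ) = x' → (((D s').σ l' x' : ringClassField K ι s'.1) : ℂ) = ((D s).σ l' x : ℂ)) ∧
      (∀ t ∈ (D s).S, ∃ t' ∈ (D s').S, ∀ (x : ringClassField K ι s.1) (x' : ringClassField K ι s'.1),
        (x : ℂ) = x' → ((t' x' : ringClassField K ι s'.1) : ℂ) = (t x : ℂ)) ∧
      (∀ t' ∈ (D s').S, ∃ t ∈ (D s).S, ∀ (x : ringClassField K ι s.1) (x' : ringClassField K ι s'.1),
        (x : ℂ) = x' → ((t' x' : ringClassField K ι s'.1) : ℂ) = (t x : ℂ)) ∧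
      (∀ (x : ringClassField K ι s.1) (x' : ringClassField K ι s'.1),
        (x : ℂ) = x' → (D s').emb x' = (D s).emb x)) :
    ∀ (s s' : {m : ℕ // Squarefree m ∧ ∀ q ∈ m.primeFactors,
        Zhang2014.IsKolyvaginPrime (W.conductorNorm ℤ) W K p q ∧ k ≤ Zhang2014.kolyvaginIndex W p q})
      (ℓ : ℕ), ℓ.Prime → ¬ ℓ ∣ s.1 → s'.1 = s.1 * ℓ →
      ∀ v : HeightOneSpectrum (𝓞 K), (ℓ : 𝓞 K) ∈ v.asIdeal →
      addOrderOf (galoisCohomology.localization ((W.baseChange K).torsionGaloisModule ((p ^ k : ℕ) : ℤ))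
          (Sum.inr v) 1 ((D s').kolyvaginClass (Fact.out : p.Prime) k)) =
        addOrderOf (galoisCohomology.localization ((W.baseChange K).torsionGaloisModule ((p ^ k : ℕ) : ℤ))
          (Sum.inr v) 1 ((D s).kolyvaginClass (Fact.out : p.Prime) k)) := by
  intro s s' ℓ hℓ hℓs hs' v hv
  haveI : ∀ j : ℕ, NumberField (ringClassField K ι j) := numberField_ringClassField K hK ι
  obtain ⟨hσ, hS1, hS2, hemb⟩ := hcompat s s' ℓ hℓ hℓs hs'
  -- transport the datum at `s'` along `s'.1 = s.1 * ℓ`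
  obtain ⟨m', hm'⟩ := s'
  change m' = s.1 * ℓ at hs'
  subst hs'
  -- the typed fact's side conditions at `s ℓ`
  have hK' : ∀ l' ∈ (s.1 * ℓ).primeFactors,
      Zhang2014.IsKolyvaginPrime (W.conductorNorm ℤ) W K p l' ∧ k ≤ Zhang2014.kolyvaginIndex W p l' :=
    hm'.2
  exact addOrderOf_localization_kolyvaginClass_mul_eq_of_prop44 h44 W hcm K hK hD3 hD4 hH p hp2 htower
    Dt β ι k hk s.1 ℓ hm'.1 hℓ hℓs hK' (D s) (D ⟨s.1 * ℓ, hm'⟩) hσ hS1 hS2 hemb v hv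

end Summit.BirchSwinnertonDyer.Rank1Residual.X11b.Three.Koly

end
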